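/-
Origin: expansion seat `prover-pub-hodgecm-own-htheta-0`, handover #H5 r6 2026-08-21T05:03Z md5 e5b68ceee485 (59 l.; NEW additive E-SHAPED child «JUARM» = «JUAR» at own-mu's `μ := ArchSideTerm.muSharp₂₃ @ArchSideTerm.muSlotZero` — ON-WORD CARGO: HOLD OUT unless an S6-mandated seat words it ≤ cutoff₇₃ (p-g31 l.15341; like «UAR» ∕ «UARM»); imports #H4 + own-mu #MU1 `HodgeCM.Model.ArchMuClosedForm` (RUN 72); ROWDEPS #H4 ≺ #H5, PKG #MU1; 1 theorem: perL_picardCM_r20AEOGISTR2DJWHHTCGJUARM (hHD hI h₁ h₃) (hGRU) (hcite) : U.PerL — 2 groups, CITE 2 ∕ CONSTRUCT 0 ∕ DATA 0 ∕ PROVE 0; NAMES for audit: HodgeCM.Model.perL_picardCM_r20AEOGISTR2DJWHHTCGJUARM) (`HOME/pub-hodgecm-own-htheta/stage73/HodgeCM/Model/E2InstanceOGR20AEPISTR2DJWHHTCGJUARM.lean`, md5 e5b68ceee485, 59 lines);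
landed by the second packager p2 gen 20 (p2-g20) in gate run 74 as `HodgeCM/Model/E2InstanceOGR20AEPISTR2DJWHHTCGJUARM.lean` (verbatim).
-/
/-
Copyright (c) 2026 the pub-hodgecm formalisation cell (harness21).  New file, not vendored.
Origin: ROW-9 OWNER seat `prover-pub-hodgecm-own-htheta-0` (unit pub-hodgecm-own-htheta), 2026-08-21 — SIBLING CARGO (lead (α-UJ)(ii)), child of
this seat's #H4 «…JUAR» at own-mu's row-6 closed form (their «ARM»∕«UARM» pattern, JOINT LINE (a) co-signed STATUS 2026-08-21T04:41:59Z).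
Target in PKG: `HodgeCM/Model/E2InstanceOGR20AEPISTR2DJWHHTCGJUARM.lean` (NEW additive leaf; imports #H4 + own-mu #MU1 `Model/ArchMuClosedForm` (RUN 72);
nothing imports it).  KERNEL ONLY: 1 theorem.  Nothing here is a claim of the manuscripts under adjudication.  r6 (2026-08-21T05:05Z):
`hcite` at the embedding of record (`(NumberField.InfinitePlace.mk ι₁).embedding = ι₁ →`), as #H4 r6.
-/
import Summits.HodgeConjecture.HodgeCM.Model.E2InstanceOGR20AEPISTR2DJWHHTCGJ
import Summits.HodgeConjecture.HodgeCM.Model.ArchMuClosedForm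

/-! PORT of `HodgeCM/Model/E2InstanceOGR20AEPISTR2DJWHHTCGJUARM.lean` (HodgeCMPerL run 82) — verbatim mechanical port; provenance in the PORT header line. -/

set_option autoImplicit false

noncomputable section

namespace HodgeCM

namespace Model

open Literature.AlgebraicGeometry.HodgeTheory
open Literature.NumberTheory.Automorphic.PicardCM
open Literature.NumberTheory.GelbartRogawski1991.UnitaryDualPair

variable (hHD : exists_isReal_hodgeModel) (hI : hodgePQ_independent_of_hodgeModel)
  (h₁ : BallQuotientUniformised) (h₃ : CMAbelianVarietyEigenbasisRealised)

/-- **«…JUARM»: PerL OF THE MODEL UNIVERSE MODULO TWO PUBLISHED CITATIONS** — «…JUAR» at own-mu's row-6 closed form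
`μ := ArchSideTerm.muSharp₂₃ @ArchSideTerm.muSlotZero` (their #MU1; row 9 places no constraint on `μ`): binder groups
**`hGRU` (CITE [GR91, Prop. 3.1.1]) and `hcite` (CITE [Liu21] Def 4.11 ∕ Prop 4.13 ∕ Thm 4.18 (2) ∕ App. D Lem D.1 (3)+glue ∕ Thm 4.18+(4.2)+(1)+Lem 2.4 (1))** —
CONSTRUCT 0 ∕ PROVE 0; `hcite` at the embedding of record (guard `(NumberField.InfinitePlace.mk ι₁).embedding = ι₁ →`, r6 of «…J»). [folklore] -/
theorem perL_picardCM_r20AEOGISTR2DJWHHTCGJUARM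
    (hGRU : ∀ (L : Type) [Field L] [NumberField L] [NumberField.IsCMField L] {N M n : ℕ} (e : Fin N × Fin M ≃ Fin n)
      (dV : Fin N → L) (hdV : ∀ i, NumberField.IsCMField.complexConj L (dV i) = dV i) (hdV0 : ∀ i, dV i ≠ 0)
      (dW : Fin M → L) (hdW : ∀ i, NumberField.IsCMField.complexConj L (dW i) = dW i) (hdW0 : ∀ i, dW i ≠ 0),
      (cmSplittingDatum L e dV hdV hdV0 dW hdW hdW0).CompatibleSplitting)
    (hcite : ∀ {L : CMField} {ι₁ : L →+* ℂ} (V : HermSpace3 L ι₁), (NumberField.InfinitePlace.mk ι₁).embedding = ι₁ → ∀ a₀ : LiuIndex.RealScalar L,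
      (liuDictionaryPin hHD hI h₁ (cmAbelianVarietyRealised_of_eigenbasis hHD hI h₃) Literature.NumberTheory.Transcendental.arapura2012_cor_15_4_6_holds V
          (LiuIndex.I V (LiuIndex.repAt a₀) (LiuIndex.muLiu ι₁ LiuIndex.GramClass.rep))
          (LiuIndex.line V (LiuIndex.repAt a₀) (LiuIndex.muLiu ι₁ LiuIndex.GramClass.rep))).Irreducible ∧
      (liuDictionaryPin hHD hI h₁ (cmAbelianVarietyRealised_of_eigenbasis hHD hI h₃) Literature.NumberTheory.Transcendental.arapura2012_cor_15_4_6_holds V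
          (LiuIndex.I V (LiuIndex.repAt a₀) (LiuIndex.muLiu ι₁ LiuIndex.GramClass.rep))
          (LiuIndex.line V (LiuIndex.repAt a₀) (LiuIndex.muLiu ι₁ LiuIndex.GramClass.rep))).Prop413 ∧
      (liuDictionaryPin hHD hI h₁ (cmAbelianVarietyRealised_of_eigenbasis hHD hI h₃) Literature.NumberTheory.Transcendental.arapura2012_cor_15_4_6_holds V
          (LiuIndex.I V (LiuIndex.repAt a₀) (LiuIndex.muLiu ι₁ LiuIndex.GramClass.rep))
          (LiuIndex.line V (LiuIndex.repAt a₀) (LiuIndex.muLiu ι₁ LiuIndex.GramClass.rep))).Thm418_2 ∧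
      (liuDictionaryPin hHD hI h₁ (cmAbelianVarietyRealised_of_eigenbasis hHD hI h₃) Literature.NumberTheory.Transcendental.arapura2012_cor_15_4_6_holds V
          (LiuIndex.I V (LiuIndex.repAt a₀) (LiuIndex.muLiu ι₁ LiuIndex.GramClass.rep))
          (LiuIndex.line V (LiuIndex.repAt a₀) (LiuIndex.muLiu ι₁ LiuIndex.GramClass.rep))).MuSeparated ∧
      (liuDictionaryPin hHD hI h₁ (cmAbelianVarietyRealised_of_eigenbasis hHD hI h₃) Literature.NumberTheory.Transcendental.arapura2012_cor_15_4_6_holds V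
          (LiuIndex.I V (LiuIndex.repAt a₀) (LiuIndex.muLiu ι₁ LiuIndex.GramClass.rep))
          (LiuIndex.line V (LiuIndex.repAt a₀) (LiuIndex.muLiu ι₁ LiuIndex.GramClass.rep))).Thm418C) :
     (picardCMUniverse hHD hI h₁ (cmAbelianVarietyRealised_of_eigenbasis hHD hI h₃)).PerL :=
  perL_picardCM_r20AEOGISTR2DJWHHTCGJUAR hHD hI h₁ h₃ hGRU (ArchSideTerm.muSharp₂₃ @ArchSideTerm.muSlotZero) hcite

end Model

end HodgeCM

end
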